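import Summits.Ventures.GridStability.Lyapunov.ConnectivityTestVector
import HarnessLib

/-!
# ConnectivityTestVectorD1 — VALIDATION of the NO-side test-vector format on D1 (sharp at the Fiedler vector)

Venture GRIDFUSION, G2-SCALE cell (lead g19 §17 (K4)), seat gridfusion-sos-5 (g9). The three-inverter dVOC network
D1 of [GrossEtAl2019] has `λ₂(L̂) = 7/125` for the weights `1/ℓ` (`ℓ = 125, 25, 25 km`), CERTIFIED densely in
`Bench.DVOC3GCBD19Cond2` (eigenbasis; Fiedler vector `(1, −1, 0)`). This file runs the SPARSE NO-side format of
`Lyapunov/ConnectivityTestVector.lean` on the same data: with the Fiedler vector as the test vector, EVERY `μ > 7/125` is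
refuted — here `μ = 57/1000 = 0.057 > 0.056` (the format is sharp: `sparseEnergy2 = 28/125 = 2·(7/125)·Σvᵢ²`). An
instrument validation (CS20 note), not a result. CERTIFIED (kernel): the three decides and the refutation.
VALIDATED / MODELLED: nothing new (weights as in `GroundedLaplacianD1Cert`). [folklore]
-/

namespace Summit.Ventures.GridStability.Bench.ConnectivityTestVectorD1

open Literature.Computation.Certificates Literature.Computation.Certificates.PSD
open Literature.MathematicalPhysics.PowerSystems Summit.Ventures.GridStability.Lyapunov

/-- Upper weights `w⁺ = 1/ℓ` exactly (node ↦ (neighbour, weight) pairs, both directions). [folklore] -/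
def Wp : SMat ℚ :=
  [[(1, ((1 : ℚ) / 125)), (2, ((1 : ℚ) / 25))],
   [(0, ((1 : ℚ) / 125)), (2, ((1 : ℚ) / 25))],
   [(0, ((1 : ℚ) / 25)), (1, ((1 : ℚ) / 25))]]

/-- The test vector: the Fiedler vector `(1, −1, 0)` of `L̂` (`Σ v = 0`). [folklore] -/
def v : List ℚ := [1, -1, 0]

/-- The refuted constant `μ = 57/1000 > λ₂(L̂) = 7/125 = 0.056`. [folklore] -/
def mu : ℚ := ((57 : ℚ) / 1000)

/-- Columns in range. [folklore] -/
theorem cols : colsBelow 3 Wp = true := by decide +kernel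

/-- `Σ v = 0` exactly. [folklore] -/
theorem vsum : ((List.range 3).map fun i => v.getD i 0).sum = 0 := by decide +kernel

/-- The Rayleigh test `ΣΣ w⁺ᵢⱼ(vᵢ − vⱼ)² = 28/125 < 2μ Σ vᵢ² = 57/250`. [folklore] -/
theorem test : sparseEnergy2 3 Wp v < 2 * mu * ((List.range 3).map fun i => v.getD i 0 ^ 2).sum := by
  decide +kernel

/-- **NO certificate on D1 at `μ = 0.057`:** for ANY real weights `a ≤ w⁺` entrywise (in particular the exact `1/ℓ`),
the connectivity hypothesis `∀ z, μ·pairNormSq z ≤ 3·½ΣΣ aᵢⱼ(zᵢ − zⱼ)²` is false. [folklore] -/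
theorem no_connectivity_certificate (a : Fin 3 → Fin 3 → ℝ)
    (ha : ∀ i j, a i j ≤ ((matrixOfSparseRows 3 3 Wp i j : ℚ) : ℝ)) :
    ¬ ∀ z : Fin 3 → ℝ,
        (mu : ℝ) * pairNormSq z ≤ (3 : ℕ) * (1 / 2 * ∑ i, ∑ j, a i j * (z i - z j) ^ 2) :=
  not_connectivity_certificate_of_testVector Wp cols v mu vsum test a ha

/-- The same for the weights `w⁺` themselves. [folklore] -/
theorem no_connectivity_certificate_self :
    ¬ ∀ z : Fin 3 → ℝ,
        (mu : ℝ) * pairNormSq z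
          ≤ (3 : ℕ) * (1 / 2 * ∑ i, ∑ j, ((matrixOfSparseRows 3 3 Wp i j : ℚ) : ℝ) * (z i - z j) ^ 2) :=
  no_connectivity_certificate _ fun _ _ => le_rfl

end Summit.Ventures.GridStability.Bench.ConnectivityTestVectorD1
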